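import Literature.Computability.AlgebraicComplexity.AndrewsForbes2022Lemma210Complex
import HarnessLib

/-!
# Andrews–Forbes 2022, Lemma 2.10 over every field of characteristic zero
(and the kernel form of the Second Fundamental Theorem for `GL_t` in characteristic zero)

Sibling proofs file of `AndrewsForbes2022Applications.lean` / `AndrewsForbes2022Lemma210Complex.lean`
(R. Andrews, M. A. Forbes, STOC 2022, arXiv:2112.00792, Construction 2.8 and Lemma 2.10, p0013) and of
`DeterminantalIdealSFT.lean`. The tree's proof of the Second Fundamental Theorem
(`SecondFundamentalTheoremGLProofs.lean`, standard-monomial argument of Arbarello–Cornalba–Griffiths–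
Harris Ch. II §3) works over any field of characteristic `0` up to its last step, where vanishing on
the complex points of the determinantal variety is converted into vanishing under the substitution
`X ↦ U Vᵀ`. Reading the argument in KERNEL form needs no points at all:

* `ArbarelloEtAl1985.mem_detIdeal_of_phi_eq_zero` — over a field of characteristic `0`, a polynomial
  killed by `φ : X ↦ U Vᵀ` (`U : m × k`, `V : n × k` generic) lies in the ideal `I_{k+1}` of
  `(k+1) × (k+1)` minors (steps C–D–F of the tree's proof, verbatim);
* `ker_genericProductHom_eq_determinantalIdeal_of_charZero` — `ker (X ↦ Y Z) = I_{t+1}(X)` for the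
  generic `m × t`, `t × n` product over a characteristic-`0` field (the `ℂ`-only
  `ker_genericProductHom_eq_determinantalIdeal` of `DeterminantalIdealSFT.lean`, generalised; its
  TODO "over an arbitrary domain" remains for positive characteristic, where the straightening step of
  the tree's proof divides by the order of a stabiliser);
* `AndrewsForbes2022_lemma_2_10_charZero` — **AF22 Lemma 2.10 for every field of characteristic `0`**
  and every `n, m, r ≥ 1`: `f(𝒢_{n,m,r-1}(Y,Z)) = 0 ↔ f ∈ I^det_{n,m,r}`. The named fact
  `AndrewsForbes2022_lemma_2_10` (EVERY field) stays open in positive characteristic only.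

Theorem-only file; no new facts. Honest framing: a characteristic-`0` instance of a typed literature
statement; VP ≠ VNP is NOT proved and nothing here bears on it.

## References
* [AndrewsForbes2022] R. Andrews, M. A. Forbes, *Ideals, determinants, and straightening: proving and
  using lower bounds for polynomial ideals*, STOC 2022, arXiv:2112.00792 — Construction 2.8, Lemma 2.10.
* [ArbarelloEtAl1985] E. Arbarello, M. Cornalba, P. A. Griffiths, J. Harris, *Geometry of Algebraic
  Curves* I, Springer 1985, Ch. II §3 (Second Fundamental Theorem), as formalised in
  `SecondFundamentalTheoremGLProofs.lean`.
* [GoodmanWallachGTM255] R. Goodman, N. Wallach, GTM 255, Thm. 12.2.12 (kernel form).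
-/

noncomputable section

open MvPolynomial

namespace Literature.Computability.AlgebraicComplexity

namespace ArbarelloEtAl1985

/-- **Kernel form of the Second Fundamental Theorem in characteristic `0`.** If `φ(P) = 0` for the
substitution `φ : X ↦ U Vᵀ` through inner dimension `k`, then `P ∈ I_{k+1}`. Proof: write
`P = i + q` with `i ∈ I_{k+1}` and `q` in the span of the values of standard tableaux with rows of
`X`-length in `[1, k]` (`mem_detIdeal_sup_span`, which needs characteristic `0`); `φ` kills `i`,
hence `q`, and the `φ`-images of those standard tableaux have distinct lex-leading monomials
(`degree_phi_tabVal`, `tabVal_eq_of_tabDeg_eq`), so `q = 0`.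
[cite: ArbarelloEtAl1985, Ch. II §3, Second Fundamental Theorem (pp. 70–74)] -/
theorem mem_detIdeal_of_phi_eq_zero {F : Type*} [Field F] [CharZero F] {k m n : ℕ}
    (P : MvPolynomial (Fin m × Fin n) F) (hφ : phi F k m n P = 0) :
    P ∈ detIdeal F m n (k + 1) := by
  classical
  obtain ⟨i, hi, q, hq, hiq⟩ :=
    Submodule.mem_sup.mp (mem_detIdeal_sup_span (F := F) (m := m) (n := n) (k := k) P)
  rw [Submodule.restrictScalars_mem] at hi
  have hφq : phi F k m n q = 0 := by
    have h1 := hφ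
    rwa [← hiq, map_add, phi_eq_zero_of_mem_detIdeal hi, zero_add] at h1
  have hq0 : q = 0 := by
    obtain ⟨c, t, ht, -, hsum⟩ := Submodule.mem_span_iff_exists_finset_subset.mp hq
    have hsum' : ∑ f ∈ t, c f • phi F k m n f = 0 := by
      have := congrArg (phi F k m n) hsum
      rw [map_sum, hφq] at this
      simpa only [map_smul] using this
    have hinj : Set.InjOn (fun f => MonomialOrder.lex.degree (phi F k m n f)) t := by
      intro f hf g hg hfg
      obtain ⟨h₁, τ₁, hτ₁, hb₁, rfl⟩ := ht hf
      obtain ⟨h₂, τ₂, hτ₂, hb₂, rfl⟩ := ht hg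
      simp only at hfg
      rw [(degree_phi_tabVal τ₁ hτ₁.1 (fun r => (hb₁ r).2)).1,
        (degree_phi_tabVal τ₂ hτ₂.1 (fun r => (hb₂ r).2)).1] at hfg
      exact tabVal_eq_of_tabDeg_eq hτ₁ hτ₂ (fun r => (hb₁ r).1) (fun r => (hb₂ r).1) _ _ hfg
    have hne : ∀ f ∈ t, phi F k m n f ≠ 0 := by
      intro f hf
      obtain ⟨h₁, τ₁, hτ₁, hb₁, rfl⟩ := ht hf
      exact MonomialOrder.leadingCoeff_ne_zero_iff.mp
        (degree_phi_tabVal τ₁ hτ₁.1 (fun r => (hb₁ r).2)).2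
    have hc := eq_zero_of_sum_smul_eq_zero t (fun f => phi F k m n f) hinj hne c hsum'
    rw [← hsum]
    exact Finset.sum_eq_zero fun f hf => by rw [hc f hf, zero_smul]
  rw [hq0, add_zero] at hiq
  rw [← hiq]
  exact hi

/-- The renaming of the variables of `F[U, V]` (`u_{i,t} = (t, castAdd i)`, `v_{j,t} = (t, natAdd j)`)
into the seed variables `(Y, Z)` of the generic product `X ↦ Y Z`: `u_{i,t} ↦ y_{i,t}`,
`v_{j,t} ↦ z_{t,j}`. [folklore] -/
private theorem genericProductHom_eq_rename_comp_phi (F : Type*) [Field F] (k m n : ℕ) :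
    (genericProductHom (Fin m) (Fin n) F k : MvPolynomial (Fin m × Fin n) F →ₐ[F] _) =
      (rename fun v : Var k m n =>
          Sum.elim (fun i : Fin m => (Sum.inl (i, (ofLex v).1) : (Fin m × Fin k) ⊕ (Fin k × Fin n)))
            (fun j : Fin n => Sum.inr ((ofLex v).1, j)) (finSumFinEquiv.symm (ofLex v).2)).comp
        (phi F k m n) := by
  refine MvPolynomial.algHom_ext fun ij => ?_
  rw [genericProductHom_X, AlgHom.comp_apply, phi_X]
  simp only [Matrix.mul_apply, Matrix.transpose_apply, Ugen, Vgen, map_sum, map_mul, rename_X]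
  refine Finset.sum_congr rfl fun t _ => ?_
  simp [uVar, vVar]

/-- The renaming above is injective (it is a bijection `u_{i,t} ↔ y_{i,t}`, `v_{j,t} ↔ z_{t,j}`).
[folklore] -/
private theorem rename_var_injective (k m n : ℕ) :
    Function.Injective fun v : Var k m n =>
      Sum.elim (fun i : Fin m => (Sum.inl (i, (ofLex v).1) : (Fin m × Fin k) ⊕ (Fin k × Fin n)))
        (fun j : Fin n => Sum.inr ((ofLex v).1, j)) (finSumFinEquiv.symm (ofLex v).2) := by
  refine Function.HasLeftInverse.injective
    ⟨Sum.elim (fun p : Fin m × Fin k => toLex (p.2, Fin.castAdd n p.1))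
      (fun p : Fin k × Fin n => toLex (p.1, Fin.natAdd m p.2)), fun v => ?_⟩
  rcases h : finSumFinEquiv.symm (ofLex v).2 with i | j
  · have hi : (ofLex v).2 = Fin.castAdd n i := by
      rw [Equiv.symm_apply_eq] at h; rw [h]; rfl
    simp only [h, Sum.elim_inl]
    rw [← hi]
    simp
  · have hj : (ofLex v).2 = Fin.natAdd m j := by
      rw [Equiv.symm_apply_eq] at h; rw [h]; rfl
    simp only [h, Sum.elim_inr]
    rw [← hj]
    simp

end ArbarelloEtAl1985

open ArbarelloEtAl1985 in
/-- **Second Fundamental Theorem, kernel form, characteristic `0`:** the kernel of the comorphism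
`μ^* : F[X] → F[Y, Z]`, `X ↦ Y Z` (`Y` generic `m × t`, `Z` generic `t × n`) is the determinantal
ideal `I_{t+1}(X)`, for every field `F` of characteristic `0`. (`⊇` over every commutative ring:
`determinantalIdeal_le_ker_genericProductHom`.)
[cite: GoodmanWallachGTM255, Thm. 12.2.12; ArbarelloEtAl1985, Ch. II §3] -/
theorem ker_genericProductHom_eq_determinantalIdeal_of_charZero (F : Type*) [Field F] [CharZero F]
    (m n t : ℕ) :
    RingHom.ker (genericProductHom (Fin m) (Fin n) F t) = determinantalIdeal (Fin m) (Fin n) F (t + 1) := by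
  refine le_antisymm ?_ (determinantalIdeal_le_ker_genericProductHom F t)
  intro P hP
  rw [RingHom.mem_ker] at hP
  rw [determinantalIdeal_eq_detIdeal]
  refine mem_detIdeal_of_phi_eq_zero P ?_
  have h := congrArg (fun g : MvPolynomial (Fin m × Fin n) F →ₐ[F] _ => g P)
    (genericProductHom_eq_rename_comp_phi F t m n)
  simp only [AlgHom.comp_apply] at h
  change genericProductHom (Fin m) (Fin n) F t P = _ at h
  rw [hP] at h
  exact rename_injective _ (rename_var_injective t m n) (by rw [map_zero]; exact h.symm)

/-- **Andrews–Forbes 2022, Lemma 2.10, over every field of characteristic `0`** (all `n, m` and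
`r ≥ 1`; the printed `r ≤ min(n,m)` is not needed): `f(𝒢_{n,m,r-1}(Y,Z)) = 0 ↔ f ∈ I^det_{n,m,r}`.
The named fact `AndrewsForbes2022_lemma_2_10` (EVERY field) remains open in positive characteristic.
[cite: AndrewsForbes2022, Lemma 2.10] -/
theorem AndrewsForbes2022_lemma_2_10_charZero (F : Type) [Field F] [CharZero F] (n m r : ℕ)
    (hr : 1 ≤ r) (f : MvPolynomial (Fin n × Fin m) F) :
    MvPolynomial.bind₁ (matrixGenerator F n m (r - 1)) f = 0 ↔ f ∈ detIdeal F n m r := by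
  obtain ⟨t, rfl⟩ : ∃ t, r = t + 1 := ⟨r - 1, by omega⟩
  rw [Nat.add_sub_cancel, ← determinantalIdeal_eq_detIdeal,
    ← ker_genericProductHom_eq_determinantalIdeal_of_charZero, RingHom.mem_ker,
    bind₁_matrixGenerator_eq_genericProductHom]

end Literature.Computability.AlgebraicComplexity

end
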